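import Literature.AlgebraicGeometry.Resolution.HasseSchmidtLocalCriterion
import Literature.AlgebraicGeometry.Resolution.AdicOrderBasics
import HarnessLib

/-!
# The LINEAR PARTS of the Hasse–Schmidt components of order `ord h − 1`, and when they reach `𝔪`-adic order exactly `1`

Topic: `Literature/AlgebraicGeometry/Resolution`. Sequel of `HasseSchmidtLocalCriterion.lean` (the UNIT form: in a local ring `O`
with a Hasse–Schmidt homomorphism `T : O → O⟦t_σ⟧`, `constantCoeff ∘ T = id`, and generators `u_i` of `𝔪` adapted to `T` to first
order, `D^{[e_j]} u_i ≡ δ_ij (mod 𝔪)`, an element `h ∈ 𝔪^{N+1} ∖ 𝔪^{N+2}` is taken to a UNIT by some component `D^{[γ]}`, `|γ| = N + 1`;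
[EGAIV4] §16.8, Thm. 16.11.2 / [Matsumura1987] §27 / [VillamayorU2008ReesDiff] §4.1, Remark 4.3). This file computes the components ONE
ORDER LOWER, modulo `𝔪²`:

* `hsComponent_sub_linearPart_mem_sq` — **`D^{[β]} h ≡ Σ_l (β_l + 1) · D^{[β + e_l]} h · u_l (mod 𝔪²)`** for `h ∈ 𝔪^{N+1}`, `|β| = N`:
  the class of `D^{[β]} h` in `𝔪/𝔪² = ⊕_l κ·ū_l` is the vector of residues `((β + e_l)_l · D^{[β+e_l]} h)_l` — the «linear part» of the
  component is read off the INITIAL FORM of `h` (whose coefficients are the residues of the `D^{[γ]} h`, `|γ| = N + 1`,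
  `HasseSchmidtLocalCriterion.order_map_residue_eq`) weighted by the exponents;
* `mem_maximalIdeal_of_sum_mul_mem_sq` — the adapted generators are linearly independent modulo `𝔪²` (`Σ a_l u_l ∈ 𝔪² ⇒ a_l ∈ 𝔪`);
* `forall_hsComponent_mem_sq_iff`, `forall_hsComponent_mem_sq_iff_dvd` — **all components of order `≤ N` of `h ∈ 𝔪^{N+1}` lie in `𝔪²`
  iff every monomial of the initial form of `h` has all its exponents divisible by the residue characteristic `p`** (`p` prime or
  `0`; «the initial form is a `p`-th power form»);
* `exists_hsComponent_adicOrder_eq_one` — hence, if `h` has order exactly `N + 1` and **`p ∤ N + 1`, some component `D^{[β]} h`,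
  `|β| = N`, has `𝔪`-adic order EXACTLY `1`** (the TAME refinement of the unit form); `dvd_of_forall_hsComponent_mem_sq` — the WILD
  alternative (`p ∣ N + 1` when all those components are in `𝔪²`).

Method: write `h = F(u)` with `F ∈ O[X_σ]` supported in degrees `≥ N + 1` (as in `HasseSchmidtLocalCriterion`), push `T(h) = Σ_d T(F_d)
∏_l T(u_l)^{d_l}` to the square-zero quotient `O/𝔪²`, where each `T(u_l)` has constant term in `𝔫 = 𝔪/𝔪²` and linear part `≡ t_l
(mod 𝔫)`, and count, in each coefficient of `∏_l T(u_l)^{d_l}`, how many factors contribute their constant term: two of them give `𝔫² = 0`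
(`coeff_prod_pow_sqZero`, private). No regularity hypothesis; the input is the same as the unit criterion's. The complete-model
(`K⟦x⟧`, `T` = Taylor) form of the same statement is `Literature.RingTheory.MvPowerSeries.forall_hasseDeriv_mem_sq_iff`
(`HasseDerivLinearPart.lean`).

Bearing (index only; nothing about the manuscript is asserted here): the Hironaka-2017 adjudication cell (`res-hironaka`), GAP row R96 /
Tier-B item E9 «LL-head deserts»: at a typed core focus of `Ê = (J, b̂)` a desert point forces the differential operators of order
`≤ b̂ − 1` applied to `J` into `𝔪²`; by this file that is the WILD regime `p ∣ b̂` (the scheme-level wrapper at closed points of smooth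
`K`-schemes, `K` perfect, follows the pattern of `SmoothStalkOrderCriterion.lean` in a separate file).

Sources: [EGAIV4] §16.8, Thm. 16.11.2; [Matsumura1987] §27 (higher derivations, Leibniz rule); [VillamayorU2008ReesDiff] §4.1, Remark 4.3.
-/

noncomputable section

namespace Literature.AlgebraicGeometry.Resolution

open Finsupp IsLocalRing MvPowerSeries

universe u v

/-! ## §1 Power series over a ring with a square-zero ideal: products of perturbed first-order-adapted series -/

section SquareZero

variable {R : Type*} [CommRing R] {σ : Type*} [Fintype σ] [DecidableEq σ]

omit [Fintype σ] [DecidableEq σ] in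
/-- Two multi-indices with `β ≤ γ` and `|γ| ≤ |β|` are equal (private helper). [folklore] -/
private theorem eq_of_le_of_degree_le' {β γ : σ →₀ ℕ} (hle : β ≤ γ) (hdeg : degree γ ≤ degree β) : β = γ := by
  obtain ⟨c, rfl⟩ := exists_add_of_le hle
  have hc : degree c = 0 := by rw [map_add] at hdeg; omega
  rw [degree_eq_zero_iff] at hc
  rw [hc, add_zero]

omit [Fintype σ] [DecidableEq σ] in
/-- A multi-index of degree `1` is a unit vector (private helper). [folklore] -/
private theorem exists_eq_single_of_degree_eq_one' {β : σ →₀ ℕ} (h : degree β = 1) : ∃ j, β = single j 1 := by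
  have hne : β ≠ 0 := fun h0 => by rw [h0, map_zero] at h; exact zero_ne_one h
  obtain ⟨j, hj⟩ := Finsupp.support_nonempty_iff.mpr hne
  refine ⟨j, ?_⟩
  have hle : single j 1 ≤ β :=
    Finsupp.single_le_iff.mpr (Nat.one_le_iff_ne_zero.mpr (Finsupp.mem_support_iff.mp hj))
  exact (eq_of_le_of_degree_le' hle (by rw [degree_single, h])).symm

/-- **Products of PERTURBED first-order-adapted series over a ring with a square-zero ideal `𝔫`.** If every
`q_l ∈ R⟦t_σ⟧` has constant term `a_l ∈ 𝔫` and linear part `≡ t_l (mod 𝔫)` and `𝔫² = 0`, then for `P = ∏_l q_l^{d_l}`: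
(i) `coeff_β P = 0` whenever `|β| + 2 ≤ |d|`; (ii) `coeff_β P = d_l · a_l` when `β + e_l = d` (`|β| + 1 = |d|`) and `0` for the
other `β` of that degree; (iii) `coeff_β P ≡ [β = d] (mod 𝔫)` when `|β| = |d|`. (Count the factors contributing their constant term:
two of them give a product in `𝔫² = 0`.) [folklore] -/
private theorem coeff_prod_pow_sqZero (𝔫 : Ideal R) (hn : 𝔫 * 𝔫 = ⊥) (q : σ → MvPowerSeries σ R)
    (h0 : ∀ l, constantCoeff (q l) ∈ 𝔫) (h1 : ∀ l j, coeff (single j 1) (q l) - (if l = j then 1 else 0) ∈ 𝔫) :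
    ∀ (n : ℕ) (d : σ →₀ ℕ), degree d = n → ∀ β : σ →₀ ℕ,
      (degree β + 2 ≤ n → coeff β (∏ l, q l ^ d l) = 0) ∧
      (degree β + 1 = n → coeff β (∏ l, q l ^ d l) =
        ∑ l, if β + single l 1 = d then (d l : R) * constantCoeff (q l) else 0) ∧
      (degree β = n → coeff β (∏ l, q l ^ d l) - (if β = d then 1 else 0) ∈ 𝔫) := by
  have hnn : ∀ {a b : R}, a ∈ 𝔫 → b ∈ 𝔫 → a * b = 0 := fun ha hb => by
    have := Ideal.mul_mem_mul ha hb
    rwa [hn, Ideal.mem_bot] at this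
  intro n
  induction n with
  | zero =>
    intro d hd β
    have hd0 : d = 0 := (degree_eq_zero_iff d).mp hd
    subst hd0
    refine ⟨fun h => by omega, fun h => by omega, fun hβ => ?_⟩
    have hβ0 : β = 0 := (degree_eq_zero_iff β).mp hβ
    subst hβ0
    simp
  | succ n ih =>
    intro d hd β
    -- split off one variable: `d = d' + e_i`
    obtain ⟨i, hi⟩ : ∃ i, d i ≠ 0 := by
      by_contra h
      simp only [not_exists, not_not] at h
      have : d = 0 := Finsupp.ext h
      rw [this, map_zero] at hd
      exact Nat.succ_ne_zero n hd.symm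
    have hile : single i 1 ≤ d := Finsupp.single_le_iff.mpr (Nat.one_le_iff_ne_zero.mpr hi)
    obtain ⟨d', hdeq⟩ := exists_add_of_le hile
    have hdeg' : degree d' = n := by
      have := congrArg degree hdeq
      rw [map_add, degree_single, hd] at this
      omega
    have hprod : (∏ l, q l ^ d l) = (∏ l, q l ^ d' l) * q i := by
      rw [hdeq]
      simp only [Finsupp.add_apply, pow_add, Finset.prod_mul_distrib]
      rw [mul_comm]
      congr 1
      rw [Finset.prod_eq_single i (fun l _ hl => by rw [single_eq_of_ne hl, pow_zero])
        (fun h => absurd (Finset.mem_univ i) h), single_eq_same, pow_one]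
    set P' := ∏ l, q l ^ d' l with hP'
    have IH := ih d' hdeg'
    rw [hprod, MvPowerSeries.coeff_mul]
    refine ⟨fun hβ => ?_, fun hβ => ?_, fun hβ => ?_⟩
    · -- (i): `|β| + 2 ≤ n + 1`
      refine Finset.sum_eq_zero fun p hp => ?_
      rw [Finset.mem_antidiagonal] at hp
      have hdegp : degree p.1 + degree p.2 = degree β := by rw [← map_add, hp]
      by_cases h2 : degree p.2 = 0
      · have hp2 : p.2 = 0 := (degree_eq_zero_iff _).mp h2
        have hp1 : p.1 = β := by rw [← hp, hp2, add_zero]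
        rw [hp2, hp1, MvPowerSeries.coeff_zero_eq_constantCoeff]
        rcases Nat.lt_or_ge (degree β + 2) (n + 1) with hlt | hge
        · rw [(IH β).1 (by omega), zero_mul]
        · -- `|β| + 1 = n`: first factor in `𝔫` by (ii), second in `𝔫`
          have hβn : degree β + 1 = n := by omega
          rw [(IH β).2.1 hβn]
          refine hnn (Ideal.sum_mem _ fun l _ => ?_) (h0 i)
          split_ifs
          · exact Ideal.mul_mem_left _ _ (h0 l)
          · exact Ideal.zero_mem _
      · rw [(IH p.1).1 (by omega), zero_mul]
    · -- (ii): `|β| + 1 = n + 1`, i.e. `|β| = n = |d'|`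
      have hβn : degree β = n := by omega
      have hterm : ∀ p ∈ Finset.antidiagonal β, coeff p.1 P' * coeff p.2 (q i) =
          (if p = (β, 0) then (if β = d' then constantCoeff (q i) else 0) else 0) +
          (if p.2 = single i 1 then
            (∑ l, if p.1 + single l 1 = d' then (d' l : R) * constantCoeff (q l) else 0) else 0) := by
        intro p hp
        rw [Finset.mem_antidiagonal] at hp
        have hdegp : degree p.1 + degree p.2 = degree β := by rw [← map_add, hp]
        by_cases h20 : p.2 = 0
        · -- constant term of `q i`
          have hp1 : p.1 = β := by rw [← hp, h20, add_zero]
          have hpeq : p = (β, 0) := Prod.ext hp1 h20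
          subst hpeq
          dsimp only
          have hne0 : ¬ ((0 : σ →₀ ℕ) = single i 1) := fun h => (Finsupp.single_ne_zero.mpr one_ne_zero) h.symm
          rw [if_pos rfl, if_neg hne0, add_zero, MvPowerSeries.coeff_zero_eq_constantCoeff]
          -- (iii) at level `n`: `coeff β P' = [β = d'] + m`
          have hm := (IH β).2.2 hβn
          have : coeff β P' = (if β = d' then 1 else 0) + (coeff β P' - if β = d' then 1 else 0) := by ring
          rw [this, add_mul, hnn hm (h0 i), add_zero]
          split_ifs <;> simp
        by_cases h21 : degree p.2 = 1
        · obtain ⟨j, hj⟩ := exists_eq_single_of_degree_eq_one' h21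
          have hpne : p ≠ (β, 0) := fun h => h20 (by rw [h])
          rw [if_neg hpne, zero_add, hj]
          have hdeg1 : degree p.1 + 1 = n := by rw [hj, degree_single] at hdegp; omega
          rw [(IH p.1).2.1 hdeg1]
          -- `coeff_{e_j} (q i) = δ_ij + m`
          have hm := h1 i j
          have hsplit : coeff (single j 1) (q i) = (if i = j then 1 else 0) + (coeff (single j 1) (q i) - if i = j then 1 else 0) := by
            ring
          have hS : (∑ l, if p.1 + single l 1 = d' then (d' l : R) * constantCoeff (q l) else 0) ∈ 𝔫 :=
            Ideal.sum_mem _ fun l _ => by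
              split_ifs
              · exact Ideal.mul_mem_left _ _ (h0 l)
              · exact Ideal.zero_mem _
          rw [hsplit, mul_add, hnn hS hm, add_zero]
          by_cases hij : i = j
          · subst hij
            rw [if_pos rfl, mul_one, if_pos rfl]
          · rw [if_neg hij, mul_zero, if_neg]
            intro h
            exact hij ((Finsupp.single_left_inj one_ne_zero).mp h).symm
        · -- `|p.2| ≥ 2`: the first factor vanishes by (i)
          have h2ge : 2 ≤ degree p.2 := by
            have : degree p.2 ≠ 0 := fun h => h20 ((degree_eq_zero_iff _).mp h)
            omega
          have hpne : p ≠ (β, 0) := fun h => h20 (by rw [h])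
          have hpne2 : p.2 ≠ single i 1 := fun h => by rw [h, degree_single] at h21; exact h21 rfl
          rw [if_neg hpne, if_neg hpne2, add_zero, (IH p.1).1 (by omega), zero_mul]
      rw [Finset.sum_congr rfl hterm, Finset.sum_add_distrib, Finset.sum_ite_eq', if_pos (by
        rw [Finset.mem_antidiagonal, add_zero])]
      -- the second sum: only the pair `(β - e_i, e_i)` (present iff `e_i ≤ β`)
      have hsum2 : (∑ p ∈ Finset.antidiagonal β, if p.2 = single i 1 then
            (∑ l, if p.1 + single l 1 = d' then (d' l : R) * constantCoeff (q l) else 0) else 0) =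
          ∑ l, if β + single l 1 = d then (d' l : R) * constantCoeff (q l) else 0 := by
        by_cases hle : single i 1 ≤ β
        · obtain ⟨β', hβ'⟩ := exists_add_of_le hle
          rw [Finset.sum_eq_single (β', single i 1)]
          · rw [if_pos rfl]
            refine Finset.sum_congr rfl fun l _ => ?_
            have : (β' + single l 1 = d') ↔ (β + single l 1 = d) := by
              rw [hβ', hdeq]
              constructor
              · intro h; rw [← h]; abel
              · intro h
                have h' : single i 1 + (β' + single l 1) = single i 1 + d' := by rw [← h]; abel
                exact add_left_cancel h'
            simp only [this]
          · intro p hp hpne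
            rw [if_neg]
            intro h2
            apply hpne
            rw [Finset.mem_antidiagonal] at hp
            refine Prod.ext ?_ h2
            have : p.1 + single i 1 = β' + single i 1 := by rw [add_comm β', ← hβ', ← hp, h2]
            exact add_right_cancel this
          · intro h
            exfalso; apply h
            rw [Finset.mem_antidiagonal, hβ', add_comm]
        · -- `β_i = 0`: no antidiagonal pair has second component `e_i`, and the right-hand sum vanishes too
          have hβi : β i = 0 := by
            by_contra hne
            exact hle (Finsupp.single_le_iff.mpr (Nat.one_le_iff_ne_zero.mpr hne))
          rw [Finset.sum_eq_zero (fun p hp => ?_)]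
          · symm
            refine Finset.sum_eq_zero fun l _ => ?_
            split_ifs with h
            · have hi' := congrArg (fun f : σ →₀ ℕ => f i) h
              simp only [Finsupp.add_apply, hβi, zero_add] at hi'
              rw [hdeq, Finsupp.add_apply, single_eq_same, Finsupp.single_apply] at hi'
              by_cases hli : l = i
              · subst hli
                rw [if_pos rfl] at hi'
                have hd'l : d' l = 0 := by omega
                rw [hd'l, Nat.cast_zero, zero_mul]
              · rw [if_neg hli] at hi'
                omega
            · rfl
          · rw [if_neg]
            intro h2
            apply hle
            rw [Finset.mem_antidiagonal] at hp
            rw [← hp, h2]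
            exact le_add_self
      rw [hsum2]
      -- assemble: `[β = d']·a_i + Σ_l [β + e_l = d] d'_l a_l = Σ_l [β + e_l = d] d_l a_l`
      have hiff : (β + single i 1 = d) ↔ (β = d') := by
        rw [hdeq, add_comm]
        exact ⟨fun h => add_left_cancel h, fun h => by rw [h]⟩
      have hsplit : ∀ l, (if β + single l 1 = d then (d l : R) * constantCoeff (q l) else 0) =
          (if β + single l 1 = d then (d' l : R) * constantCoeff (q l) else 0) +
            (if l = i then (if β = d' then constantCoeff (q i) else 0) else 0) := by
        intro l
        by_cases hli : l = i
        · subst hli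
          simp only [hiff, if_true]
          split_ifs with hb
          · rw [hdeq, Finsupp.add_apply, single_eq_same, Nat.cast_add, Nat.cast_one, add_mul, one_mul, add_comm]
          · rw [add_zero]
        · rw [if_neg hli, add_zero]
          split_ifs with hb
          · rw [hdeq, Finsupp.add_apply, Finsupp.single_apply, if_neg (fun h => hli h.symm), zero_add]
          · rfl
      rw [Finset.sum_congr rfl (fun l _ => hsplit l), Finset.sum_add_distrib, Finset.sum_ite_eq' Finset.univ i,
        if_pos (Finset.mem_univ i), add_comm]
    · -- (iii): `|β| = n + 1 = |d|`
      -- the «main value» of an antidiagonal term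
      have hmain : (if β = d then (1 : R) else 0) =
          ∑ p ∈ Finset.antidiagonal β, if p = (d', single i 1) then (1 : R) else 0 := by
        rw [Finset.sum_ite_eq']
        by_cases hb : β = d
        · rw [if_pos hb, if_pos]
          rw [Finset.mem_antidiagonal, hb, hdeq, add_comm]
        · rw [if_neg hb, if_neg]
          intro hmem
          apply hb
          rw [Finset.mem_antidiagonal] at hmem
          rw [← hmem, hdeq, add_comm]
      rw [hmain, ← Finset.sum_sub_distrib]
      refine Ideal.sum_mem _ fun p hp => ?_
      rw [Finset.mem_antidiagonal] at hp
      have hdegp : degree p.1 + degree p.2 = degree β := by rw [← map_add, hp]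
      by_cases h20 : p.2 = 0
      · have hpne : p ≠ (d', single i 1) := fun h => by
          rw [h] at h20; exact (Finsupp.single_ne_zero.mpr one_ne_zero) h20
        rw [if_neg hpne, sub_zero, h20, MvPowerSeries.coeff_zero_eq_constantCoeff]
        exact Ideal.mul_mem_left _ _ (h0 i)
      by_cases h21 : degree p.2 = 1
      · obtain ⟨j, hj⟩ := exists_eq_single_of_degree_eq_one' h21
        have hdeg1 : degree p.1 = n := by rw [hj, degree_single] at hdegp; omega
        have hm₁ := (IH p.1).2.2 hdeg1
        have hm₂ := h1 i j
        -- `c₁ c₂ − ε₁ ε₂ = (c₁ − ε₁) c₂ + ε₁ (c₂ − ε₂)`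
        have hM : (if p = (d', single i 1) then (1 : R) else 0) =
            (if p.1 = d' then (1 : R) else 0) * (if i = j then 1 else 0) := by
          by_cases hp1 : p.1 = d'
          · by_cases hij : i = j
            · subst hij
              rw [if_pos (Prod.ext hp1 hj), if_pos hp1, if_pos rfl, mul_one]
            · rw [if_neg, if_pos hp1, if_neg hij, mul_zero]
              intro h
              apply hij
              have := congrArg Prod.snd h
              rw [hj] at this
              exact ((Finsupp.single_left_inj one_ne_zero).mp this).symm
          · rw [if_neg (fun h => hp1 (congrArg Prod.fst h)), if_neg hp1, zero_mul]
        rw [hM, hj]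
        have hring : coeff p.1 P' * coeff (single j 1) (q i) - (if p.1 = d' then (1 : R) else 0) * (if i = j then 1 else 0) =
            (coeff p.1 P' - if p.1 = d' then (1 : R) else 0) * coeff (single j 1) (q i) +
              (if p.1 = d' then (1 : R) else 0) * (coeff (single j 1) (q i) - if i = j then 1 else 0) := by ring
        rw [hring]
        exact Ideal.add_mem _ (Ideal.mul_mem_right _ _ hm₁) (Ideal.mul_mem_left _ _ hm₂)
      · -- `|p.2| ≥ 2`
        have h2ge : 2 ≤ degree p.2 := by
          have : degree p.2 ≠ 0 := fun h => h20 ((degree_eq_zero_iff _).mp h)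
          omega
        have hpne : p ≠ (d', single i 1) := fun h => by
          rw [h, degree_single] at h21; exact h21 rfl
        rw [if_neg hpne, sub_zero]
        rcases Nat.lt_or_ge (degree p.1 + 2) (n + 1) with hlt | hge
        · rw [(IH p.1).1 (by omega), zero_mul]
          exact Ideal.zero_mem _
        · have hdeg1 : degree p.1 + 1 = n := by omega
          rw [(IH p.1).2.1 hdeg1]
          refine Ideal.mul_mem_right _ _ (Ideal.sum_mem _ fun l _ => ?_)
          split_ifs
          · exact Ideal.mul_mem_left _ _ (h0 l)
          · exact Ideal.zero_mem _


end SquareZero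

/-! ## §2 The linear parts of the Hasse–Schmidt components in a local ring with adapted generators of `𝔪` -/

section LocalCriterion

variable {O : Type v} [CommRing O] [IsLocalRing O] {σ : Type*} [Fintype σ] [DecidableEq σ]
  (T : O →+* MvPowerSeries σ O)

omit [IsLocalRing O] [Fintype σ] [DecidableEq σ] in
/-- The coefficients of `T(h)` pushed to a quotient are the classes of the Hasse–Schmidt components (bookkeeping). [folklore] -/
private theorem coeff_map_mk_apply (I : Ideal O) (β : σ →₀ ℕ) (h : O) :
    coeff β (MvPowerSeries.map (Ideal.Quotient.mk I) (T h)) = Ideal.Quotient.mk I (hsComponent T β h) := by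
  rw [MvPowerSeries.coeff_map]
  rfl

omit [Fintype σ] in
/-- **`D^{[e_j]}(a·u) ≡ a·δ_{u}` (mod `𝔪`)** for `u ∈ 𝔪` with `D^{[e_j]} u ≡ δ (mod 𝔪)` — Leibniz on the antidiagonal of `e_j`.
[cite: Matsumura1987, §27 (higher derivations, Leibniz rule)] -/
theorem hsComponent_single_mul_sub_mem (hT0 : ∀ b, constantCoeff (T b) = b) (j : σ) {a u δ : O}
    (hu : u ∈ maximalIdeal O) (hδ : hsComponent T (single j 1) u - δ ∈ maximalIdeal O) :
    hsComponent T (single j 1) (a * u) - a * δ ∈ maximalIdeal O := by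
  rw [hsComponent_mul]
  have hmem : ((0 : σ →₀ ℕ), single j 1) ∈ Finset.antidiagonal (single j 1) := by
    rw [Finset.mem_antidiagonal, zero_add]
  rw [← Finset.add_sum_erase _ _ hmem, hsComponent_zero T hT0]
  -- main term `a · D^{[e_j]} u ≡ a δ`, the other term is `D^{[e_j]} a · u ∈ 𝔪`
  have hrest : ∑ p ∈ (Finset.antidiagonal (single j 1)).erase ((0 : σ →₀ ℕ), single j 1),
      hsComponent T p.1 a * hsComponent T p.2 u ∈ maximalIdeal O := by
    refine Ideal.sum_mem _ fun p hp => ?_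
    rw [Finset.mem_erase, Finset.mem_antidiagonal] at hp
    -- `p.2 < e_j` forces `p.2 = 0`
    have hp2 : p.2 = 0 := by
      by_contra hne
      apply hp.1
      have hle : p.2 ≤ single j 1 := by rw [← hp.2]; exact le_add_self
      have hdeg : degree p.2 ≤ 1 := by
        have := congrArg degree hp.2
        rw [map_add, degree_single] at this; omega
      have hdeg1 : degree p.2 = 1 := by
        have : degree p.2 ≠ 0 := fun h0 => hne ((degree_eq_zero_iff _).mp h0)
        omega
      have h2 : p.2 = single j 1 := eq_of_le_of_degree_le' hle (by rw [degree_single, hdeg1])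
      have h1 : p.1 = 0 := by
        have := hp.2; rw [h2] at this
        simpa using this
      exact Prod.ext h1 h2
    rw [hp2, hsComponent_zero T hT0]
    exact Ideal.mul_mem_left _ _ hu
  have : a * hsComponent T (single j 1) u + ∑ p ∈ (Finset.antidiagonal (single j 1)).erase ((0 : σ →₀ ℕ), single j 1),
      hsComponent T p.1 a * hsComponent T p.2 u - a * δ =
      a * (hsComponent T (single j 1) u - δ) + ∑ p ∈ (Finset.antidiagonal (single j 1)).erase ((0 : σ →₀ ℕ), single j 1),
      hsComponent T p.1 a * hsComponent T p.2 u := by ring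
  rw [this]
  exact Ideal.add_mem _ (Ideal.mul_mem_left _ _ hδ) hrest

/-- **The adapted generators are linearly independent modulo `𝔪²`**: if `Σ_l a_l u_l ∈ 𝔪²` then every `a_j ∈ 𝔪` (apply
`D^{[e_j]}`, which maps `𝔪²` into `𝔪`). [cite: Matsumura1987, §27 (higher derivations, Leibniz rule)] -/
theorem mem_maximalIdeal_of_sum_mul_mem_sq (hT0 : ∀ b, constantCoeff (T b) = b) {u : σ → O}
    (hu : Ideal.span (Set.range u) = maximalIdeal O)
    (hlin : ∀ i j, hsComponent T (single j 1) (u i) - (if i = j then 1 else 0) ∈ maximalIdeal O)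
    (a : σ → O) (h : ∑ l, a l * u l ∈ maximalIdeal O ^ 2) (j : σ) : a j ∈ maximalIdeal O := by
  have hu𝔪 : ∀ i, u i ∈ maximalIdeal O := fun i => hu ▸ Ideal.subset_span ⟨i, rfl⟩
  -- `D^{[e_j]}` of the relation lies in `𝔪`
  have hD : hsComponent T (single j 1) (∑ l, a l * u l) ∈ maximalIdeal O := by
    have := hsComponent_mem_pow T hT0 (maximalIdeal O) 2 (single j 1) h
    rwa [degree_single, show 2 - 1 = 1 by rfl, pow_one] at this
  have hsum : hsComponent T (single j 1) (∑ l, a l * u l) = ∑ l, hsComponent T (single j 1) (a l * u l) := by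
    simp only [hsComponent, map_sum]
  rw [hsum] at hD
  -- and it is `≡ Σ_l a_l δ_{lj} = a_j`
  have hdiff : ∑ l, hsComponent T (single j 1) (a l * u l) - ∑ l, a l * (if l = j then 1 else 0) ∈ maximalIdeal O := by
    rw [← Finset.sum_sub_distrib]
    exact Ideal.sum_mem _ fun l _ => hsComponent_single_mul_sub_mem T hT0 j (hu𝔪 l) (hlin l j)
  simp only [mul_ite, mul_one, mul_zero, Finset.sum_ite_eq', Finset.mem_univ, if_true] at hdiff
  have : a j = ∑ l, hsComponent T (single j 1) (a l * u l) -
      (∑ l, hsComponent T (single j 1) (a l * u l) - a j) := by ring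
  rw [this]
  exact Ideal.sub_mem _ hD hdiff

/-- **MAIN LEMMA — the linear parts of the components of order `N` of an element of `𝔪^{N+1}`.** For a Hasse–Schmidt
homomorphism `T` (`constantCoeff ∘ T = id`) with generators `u_i` of `𝔪` adapted to first order, `h ∈ 𝔪^{N+1}` and `|β| = N`:
`D^{[β]} h ≡ Σ_l (β_l + 1) · D^{[β+e_l]} h · u_l (mod 𝔪²)`. (Write `h = F(u)` with `F` supported in degrees `≥ N+1`; push `T(h) =
Σ_d T(F_d) ∏ T(u_l)^{d_l}` to `O/𝔪²`, where `𝔫 = 𝔪/𝔪²` is square-zero and `T(u_l)` has constant term in `𝔫` and linear part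
`≡ t_l`; read off the degree-`N` coefficients with `coeff_prod_pow_sqZero`, and identify `F_γ ≡ D^{[γ]} h (mod 𝔪)` in degree
`N + 1`.) [cite: Matsumura1987, §27 (higher derivations)] [cite: VillamayorU2008ReesDiff, §4.1 and Remark 4.3] -/
theorem hsComponent_sub_linearPart_mem_sq (hT0 : ∀ b, constantCoeff (T b) = b) {u : σ → O}
    (hu : Ideal.span (Set.range u) = maximalIdeal O)
    (hlin : ∀ i j, hsComponent T (single j 1) (u i) - (if i = j then 1 else 0) ∈ maximalIdeal O)
    {N : ℕ} {h : O} (hh : h ∈ maximalIdeal O ^ (N + 1)) (β : σ →₀ ℕ) (hβ : degree β = N) :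
    hsComponent T β h - ∑ l, ((β l + 1 : ℕ) : O) * hsComponent T (β + single l 1) h * u l ∈
      maximalIdeal O ^ 2 := by
  classical
  have hu𝔪 : ∀ i, u i ∈ maximalIdeal O := fun i => hu ▸ Ideal.subset_span ⟨i, rfl⟩
  -- the square-zero quotient `O/𝔪²`, `𝔫 = 𝔪/𝔪²`
  set I : Ideal O := maximalIdeal O ^ 2 with hI
  set mk : O →+* O ⧸ I := Ideal.Quotient.mk I with hmk
  set 𝔫 : Ideal (O ⧸ I) := (maximalIdeal O).map mk with h𝔫
  have hn : 𝔫 * 𝔫 = ⊥ := by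
    rw [h𝔫, ← Ideal.map_mul, ← sq]
    exact Ideal.map_quotient_self I
  have hmem𝔫 : ∀ {x : O}, x ∈ maximalIdeal O → mk x ∈ 𝔫 := fun hx => Ideal.mem_map_of_mem _ hx
  -- the pushed-forward series `q_l = T(u_l) mod 𝔪²`
  set q : σ → MvPowerSeries σ (O ⧸ I) := fun l => MvPowerSeries.map mk (T (u l)) with hq
  have hq0 : ∀ l, constantCoeff (q l) ∈ 𝔫 := by
    intro l
    show constantCoeff (MvPowerSeries.map mk (T (u l))) ∈ 𝔫
    rw [← MvPowerSeries.coeff_zero_eq_constantCoeff_apply, coeff_map_mk_apply, hsComponent_zero T hT0]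
    exact hmem𝔫 (hu𝔪 l)
  have hq1 : ∀ l j, coeff (single j 1) (q l) - (if l = j then 1 else 0) ∈ 𝔫 := by
    intro l j
    show coeff (single j 1) (MvPowerSeries.map mk (T (u l))) - _ ∈ 𝔫
    rw [coeff_map_mk_apply]
    have hδ : (if l = j then (1 : O ⧸ I) else 0) = mk (if l = j then 1 else 0) := by
      split_ifs <;> simp
    rw [hδ, ← map_sub]
    exact hmem𝔫 (hlin l j)
  -- write `h = F(u)` with `F` supported in degrees `≥ N + 1`
  have hmap : (MvPolynomial.idealOfVars σ O).map (MvPolynomial.eval u) = maximalIdeal O := by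
    rw [MvPolynomial.idealOfVars, Ideal.map_span, ← Set.range_comp, ← hu]
    congr 1
    ext x
    simp
  have hF : ∃ F : MvPolynomial σ O, (∀ d ∈ F.support, N + 1 ≤ degree d) ∧ MvPolynomial.eval u F = h := by
    have hN := hh
    rw [← hmap, ← Ideal.map_pow, Ideal.mem_map_iff_of_surjective _
      (fun a => ⟨MvPolynomial.C a, MvPolynomial.eval_C a⟩)] at hN
    obtain ⟨F, hF, hFh⟩ := hN
    rw [MvPolynomial.mem_pow_idealOfVars_iff] at hF
    exact ⟨F, hF, hFh⟩
  obtain ⟨F, hFdeg, hFh⟩ := hF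
  -- `T(h) mod 𝔪² = Σ_d T(F_d) · ∏ q_l^{d_l}`
  have hev : MvPowerSeries.map mk (T h) =
      ∑ d ∈ F.support, ((MvPowerSeries.map mk).comp T) (MvPolynomial.coeff d F) * ∏ l, q l ^ d l := by
    rw [← hFh, MvPolynomial.eval, MvPolynomial.coe_eval₂Hom, ← RingHom.comp_apply, MvPolynomial.eval₂_comp_left,
      MvPolynomial.eval₂_eq']
    rfl
  have hconst : ∀ d : σ →₀ ℕ, constantCoeff (((MvPowerSeries.map mk).comp T) (MvPolynomial.coeff d F)) =
      mk (MvPolynomial.coeff d F) := by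
    intro d
    rw [RingHom.comp_apply, ← MvPowerSeries.coeff_zero_eq_constantCoeff_apply, coeff_map_mk_apply,
      hsComponent_zero T hT0]
  have SQ := coeff_prod_pow_sqZero 𝔫 hn q hq0 hq1
  -- coefficients of `s · ∏ q^d` in degree `N` (`|d| ≥ N + 1`): only `(0, β)` contributes, and only if `|d| = N + 1`
  have hcoeffN : ∀ (s : MvPowerSeries σ (O ⧸ I)) (d : σ →₀ ℕ), N + 1 ≤ degree d →
      coeff β (s * ∏ l, q l ^ d l) =
        if degree d = N + 1 then
          constantCoeff s * ∑ l, (if β + single l 1 = d then (d l : O ⧸ I) * constantCoeff (q l) else 0)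
        else 0 := by
    intro s d hd
    rw [MvPowerSeries.coeff_mul, Finset.sum_eq_single ((0 : σ →₀ ℕ), β)]
    · rw [MvPowerSeries.coeff_zero_eq_constantCoeff]
      split_ifs with hdeg
      · rw [((SQ (N + 1) d hdeg) β).2.1 (by omega)]
      · rw [((SQ (degree d) d rfl) β).1 (by omega), mul_zero]
    · intro p hp hpne
      rw [Finset.mem_antidiagonal] at hp
      have hdegp : degree p.1 + degree p.2 = degree β := by rw [← map_add, hp]
      have hp2 : degree p.2 + 2 ≤ degree d := by
        by_contra hlt
        apply hpne
        have hdeg2 : degree p.2 = N := by omega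
        have hp2β : p.2 = β := eq_of_le_of_degree_le' (by rw [← hp]; exact le_add_self) (by rw [hβ, hdeg2])
        have hp10 : p.1 = 0 := by
          have := hp
          rw [hp2β] at this
          simpa using this
        exact Prod.ext hp10 hp2β
      rw [((SQ (degree d) d rfl) p.2).1 hp2, mul_zero]
    · intro hnot
      exfalso; apply hnot
      rw [Finset.mem_antidiagonal, zero_add]
  -- coefficients in degree `N + 1`: `≡ [γ = d] · s(0)` modulo `𝔫`
  have hcoeffN1 : ∀ (s : MvPowerSeries σ (O ⧸ I)) (d γ : σ →₀ ℕ), N + 1 ≤ degree d → degree γ = N + 1 →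
      coeff γ (s * ∏ l, q l ^ d l) - (if γ = d then constantCoeff s else 0) ∈ 𝔫 := by
    intro s d γ hd hγ
    rw [MvPowerSeries.coeff_mul]
    have hmem : ((0 : σ →₀ ℕ), γ) ∈ Finset.antidiagonal γ := by rw [Finset.mem_antidiagonal, zero_add]
    rw [← Finset.add_sum_erase _ _ hmem, MvPowerSeries.coeff_zero_eq_constantCoeff]
    have hmain : constantCoeff s * coeff γ (∏ l, q l ^ d l) - (if γ = d then constantCoeff s else 0) ∈ 𝔫 := by
      by_cases hdeg : degree d = N + 1
      · have h3 := ((SQ (N + 1) d hdeg) γ).2.2 hγ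
        have : constantCoeff s * coeff γ (∏ l, q l ^ d l) - (if γ = d then constantCoeff s else 0) =
            constantCoeff s * (coeff γ (∏ l, q l ^ d l) - if γ = d then 1 else 0) := by
          split_ifs <;> ring
        rw [this]
        exact Ideal.mul_mem_left _ _ h3
      · have hne : γ ≠ d := fun h => hdeg (by rw [← h, hγ])
        rw [if_neg hne, sub_zero]
        rcases Nat.lt_or_ge (degree γ + 2) (degree d + 1) with hlt | hge
        · rw [((SQ (degree d) d rfl) γ).1 (by omega), mul_zero]; exact Ideal.zero_mem _
        · have h2 : degree γ + 1 = degree d := by omega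
          rw [((SQ (degree d) d rfl) γ).2.1 h2]
          refine Ideal.mul_mem_left _ _ (Ideal.sum_mem _ fun l _ => ?_)
          split_ifs
          · exact Ideal.mul_mem_left _ _ (hq0 l)
          · exact Ideal.zero_mem _
    have hrest : ∑ p ∈ (Finset.antidiagonal γ).erase ((0 : σ →₀ ℕ), γ),
        coeff p.1 s * coeff p.2 (∏ l, q l ^ d l) ∈ 𝔫 := by
      refine Ideal.sum_mem _ fun p hp => ?_
      rw [Finset.mem_erase, Finset.mem_antidiagonal] at hp
      have hdegp : degree p.1 + degree p.2 = degree γ := by rw [← map_add, hp.2]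
      have hp2 : degree p.2 ≤ N := by
        by_contra hlt
        apply hp.1
        have hdeg2 : degree p.2 = N + 1 := by omega
        have hp2γ : p.2 = γ := eq_of_le_of_degree_le' (by rw [← hp.2]; exact le_add_self) (by rw [hγ, hdeg2])
        have hp10 : p.1 = 0 := by
          have := hp.2
          rw [hp2γ] at this
          simpa using this
        exact Prod.ext hp10 hp2γ
      rcases Nat.lt_or_ge (degree p.2 + 2) (degree d + 1) with hlt | hge
      · rw [((SQ (degree d) d rfl) p.2).1 (by omega), mul_zero]; exact Ideal.zero_mem _
      · have h2 : degree p.2 + 1 = degree d := by omega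
        rw [((SQ (degree d) d rfl) p.2).2.1 h2]
        refine Ideal.mul_mem_left _ _ (Ideal.sum_mem _ fun l _ => ?_)
        split_ifs
        · exact Ideal.mul_mem_left _ _ (hq0 l)
        · exact Ideal.zero_mem _
    have : constantCoeff s * coeff γ (∏ l, q l ^ d l) +
        ∑ p ∈ (Finset.antidiagonal γ).erase ((0 : σ →₀ ℕ), γ), coeff p.1 s * coeff p.2 (∏ l, q l ^ d l) -
        (if γ = d then constantCoeff s else 0) =
      (constantCoeff s * coeff γ (∏ l, q l ^ d l) - (if γ = d then constantCoeff s else 0)) +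
        ∑ p ∈ (Finset.antidiagonal γ).erase ((0 : σ →₀ ℕ), γ), coeff p.1 s * coeff p.2 (∏ l, q l ^ d l) := by
      ring
    rw [this]
    exact Ideal.add_mem _ hmain hrest
  -- (A) `D^{[γ]} h ≡ F_γ (mod 𝔪)` for `|γ| = N + 1`
  have hA : ∀ γ : σ →₀ ℕ, degree γ = N + 1 → hsComponent T γ h - MvPolynomial.coeff γ F ∈ maximalIdeal O := by
    intro γ hγ
    have h1 : mk (hsComponent T γ h) - mk (MvPolynomial.coeff γ F) ∈ 𝔫 := by
      rw [← coeff_map_mk_apply, hev, map_sum]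
      have hsplit : mk (MvPolynomial.coeff γ F) =
          ∑ d ∈ F.support, if γ = d then constantCoeff (((MvPowerSeries.map mk).comp T) (MvPolynomial.coeff d F))
            else 0 := by
        rw [Finset.sum_ite_eq]
        split_ifs with hγmem
        · rw [hconst]
        · rw [MvPolynomial.notMem_support_iff.mp hγmem, map_zero]
      rw [hsplit, ← Finset.sum_sub_distrib]
      exact Ideal.sum_mem _ fun d hd => hcoeffN1 _ d γ (hFdeg d hd) hγ
    rw [← map_sub] at h1
    have h2 : hsComponent T γ h - MvPolynomial.coeff γ F ∈ 𝔫.comap mk := h1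
    rw [h𝔫, Ideal.comap_map_of_surjective _ Ideal.Quotient.mk_surjective] at h2
    have hker : Ideal.comap mk ⊥ = I := by rw [hmk, ← RingHom.ker_eq_comap_bot, Ideal.mk_ker]
    rw [hker] at h2
    have hle : maximalIdeal O ⊔ I ≤ maximalIdeal O :=
      sup_le le_rfl (by rw [hI]; exact Ideal.pow_le_self two_ne_zero)
    exact hle h2
  -- (B) `D^{[β]} h ≡ Σ_l (β_l+1) F_{β+e_l} u_l (mod 𝔪²)`
  have hB : mk (hsComponent T β h) = ∑ l, mk (((β l + 1 : ℕ) : O) * MvPolynomial.coeff (β + single l 1) F * u l) := by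
    rw [← coeff_map_mk_apply, hev, map_sum]
    have hterm : ∀ d ∈ F.support,
        coeff β (((MvPowerSeries.map mk).comp T) (MvPolynomial.coeff d F) * ∏ l, q l ^ d l) =
          ∑ l, if β + single l 1 = d then mk (((β l + 1 : ℕ) : O) * MvPolynomial.coeff d F * u l) else 0 := by
      intro d hd
      rw [hcoeffN _ d (hFdeg d hd)]
      split_ifs with hdeg
      · rw [hconst, Finset.mul_sum]
        refine Finset.sum_congr rfl fun l _ => ?_
        split_ifs with hl
        · have hdl : d l = β l + 1 := by rw [← hl, Finsupp.add_apply, single_eq_same]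
          have hc : constantCoeff (q l) = mk (u l) := by
            show constantCoeff (MvPowerSeries.map mk (T (u l))) = mk (u l)
            rw [← MvPowerSeries.coeff_zero_eq_constantCoeff_apply, coeff_map_mk_apply, hsComponent_zero T hT0]
          rw [hdl, hc, map_mul, map_mul, map_natCast]
          ring
        · rw [mul_zero]
      · symm
        refine Finset.sum_eq_zero fun l _ => ?_
        rw [if_neg]
        intro hl
        apply hdeg
        rw [← hl, map_add, degree_single, hβ]
    rw [Finset.sum_congr rfl hterm, Finset.sum_comm]
    refine Finset.sum_congr rfl fun l _ => ?_
    rw [Finset.sum_ite_eq]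
    split_ifs with hmem
    · rfl
    · rw [MvPolynomial.notMem_support_iff.mp hmem, mul_zero, zero_mul, map_zero]
  -- conclusion: the difference lies in `𝔪²`
  rw [← Ideal.Quotient.eq_zero_iff_mem, show Ideal.Quotient.mk (maximalIdeal O ^ 2) = mk from rfl, map_sub, hB,
    map_sum, ← Finset.sum_sub_distrib]
  refine Finset.sum_eq_zero fun l _ => ?_
  rw [← map_sub, Ideal.Quotient.eq_zero_iff_mem]
  have : ((β l + 1 : ℕ) : O) * MvPolynomial.coeff (β + single l 1) F * u l -
      ((β l + 1 : ℕ) : O) * hsComponent T (β + single l 1) h * u l =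
      -(((β l + 1 : ℕ) : O) * ((hsComponent T (β + single l 1) h - MvPolynomial.coeff (β + single l 1) F) * u l)) := by
    ring
  rw [this, hI, sq]
  have hγ : degree (β + single l 1) = N + 1 := by rw [map_add, degree_single, hβ]
  exact neg_mem (Ideal.mul_mem_left _ _ (Ideal.mul_mem_mul (hA _ hγ) (hu𝔪 l)))

end LocalCriterion

/-! ## §3 The criterion: all components of order `≤ N` in `𝔪²` iff the initial form is a `p`-th power form -/

section Criterion

variable {O : Type v} [CommRing O] [IsLocalRing O] {σ : Type*} [Fintype σ] [DecidableEq σ]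
  (T : O →+* MvPowerSeries σ O)

/-- **All Hasse–Schmidt components of order `≤ N` of `h ∈ 𝔪^{N+1}` lie in `𝔪²` iff `γ_l · D^{[γ]} h ∈ 𝔪` for every `|γ| = N+1`
and every `l`** (the residues of the `D^{[γ]} h`, `|γ| = N + 1`, are the coefficients of the initial form of `h`; the condition says
each of its monomials has all exponents `≡ 0` in the residue field). [cite: Matsumura1987, §27 (higher derivations)]
[cite: VillamayorU2008ReesDiff, §4.1 and Remark 4.3] -/
theorem forall_hsComponent_mem_sq_iff (hT0 : ∀ b, constantCoeff (T b) = b) {u : σ → O}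
    (hu : Ideal.span (Set.range u) = maximalIdeal O)
    (hlin : ∀ i j, hsComponent T (single j 1) (u i) - (if i = j then 1 else 0) ∈ maximalIdeal O)
    {N : ℕ} {h : O} (hh : h ∈ maximalIdeal O ^ (N + 1)) :
    (∀ β : σ →₀ ℕ, degree β ≤ N → hsComponent T β h ∈ maximalIdeal O ^ 2) ↔
      ∀ γ : σ →₀ ℕ, degree γ = N + 1 → ∀ l, ((γ l : ℕ) : O) * hsComponent T γ h ∈ maximalIdeal O := by
  have hu𝔪 : ∀ i, u i ∈ maximalIdeal O := fun i => hu ▸ Ideal.subset_span ⟨i, rfl⟩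
  constructor
  · intro H γ hγ l
    by_cases hl : γ l = 0
    · rw [hl, Nat.cast_zero, zero_mul]; exact Ideal.zero_mem _
    · -- `γ = β + e_l`, `|β| = N`
      have hle : single l 1 ≤ γ := Finsupp.single_le_iff.mpr (Nat.one_le_iff_ne_zero.mpr hl)
      obtain ⟨β, rfl⟩ : ∃ β, γ = β + single l 1 := ⟨γ - single l 1, (tsub_add_cancel_of_le hle).symm⟩
      have hβ : degree β = N := by rw [map_add, degree_single] at hγ; omega
      have hsum : ∑ l', ((β l' + 1 : ℕ) : O) * hsComponent T (β + single l' 1) h * u l' ∈ maximalIdeal O ^ 2 := by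
        have h1 := hsComponent_sub_linearPart_mem_sq T hT0 hu hlin hh β hβ
        have h2 := H β hβ.le
        have : ∑ l', ((β l' + 1 : ℕ) : O) * hsComponent T (β + single l' 1) h * u l' =
            hsComponent T β h - (hsComponent T β h - ∑ l', ((β l' + 1 : ℕ) : O) * hsComponent T (β + single l' 1) h * u l') := by
          ring
        rw [this]
        exact Ideal.sub_mem _ h2 h1
      have := mem_maximalIdeal_of_sum_mul_mem_sq T hT0 hu hlin
        (fun l' => ((β l' + 1 : ℕ) : O) * hsComponent T (β + single l' 1) h) hsum l
      rwa [Finsupp.add_apply, single_eq_same]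
  · intro H β hβ
    rcases hβ.lt_or_eq with hlt | heq
    · -- order `< N`: `D^{[β]} h ∈ 𝔪^{N+1-|β|} ⊆ 𝔪²`
      have := hsComponent_mem_pow T hT0 (maximalIdeal O) (N + 1) β hh
      exact Ideal.pow_le_pow_right (by omega) this
    · have h1 := hsComponent_sub_linearPart_mem_sq T hT0 hu hlin hh β heq
      have hsum : ∑ l, ((β l + 1 : ℕ) : O) * hsComponent T (β + single l 1) h * u l ∈ maximalIdeal O ^ 2 := by
        refine Ideal.sum_mem _ fun l _ => ?_
        rw [sq]
        refine Ideal.mul_mem_mul ?_ (hu𝔪 l)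
        have := H (β + single l 1) (by rw [map_add, degree_single, heq]) l
        rwa [Finsupp.add_apply, single_eq_same] at this
      have : hsComponent T β h = (hsComponent T β h - ∑ l, ((β l + 1 : ℕ) : O) * hsComponent T (β + single l 1) h * u l) +
          ∑ l, ((β l + 1 : ℕ) : O) * hsComponent T (β + single l 1) h * u l := by ring
      rw [this]
      exact Ideal.add_mem _ h1 hsum

/-- A natural number maps into `𝔪` iff the residue characteristic divides it. [folklore] -/
private theorem natCast_mem_maximalIdeal_iff (p : ℕ) [CharP (ResidueField O) p] (n : ℕ) :
    (n : O) ∈ maximalIdeal O ↔ p ∣ n := by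
  rw [← residue_eq_zero_iff, map_natCast, CharP.cast_eq_zero_iff (ResidueField O) p]

omit [Fintype σ] [DecidableEq σ] in
/-- A multi-index of total degree prime to `p` has a coordinate prime to `p`. [folklore] -/
private theorem exists_not_dvd_apply {p : ℕ} {β : σ →₀ ℕ} (h : ¬ p ∣ degree β) : ∃ i, ¬ p ∣ β i := by
  by_contra hall
  simp only [not_exists, not_not] at hall
  exact h (by rw [Finsupp.degree_apply]; exact Finset.dvd_sum fun i _ => hall i)

/-- **The criterion in terms of the residue characteristic `p`** (`p` prime or `0`): all components `D^{[β]} h`, `|β| ≤ N`, of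
`h ∈ 𝔪^{N+1}` lie in `𝔪²` iff every `γ` of degree `N + 1` with `D^{[γ]} h ∉ 𝔪` (a monomial of the initial form) has ALL its
coordinates divisible by `p` — «the initial form of `h` is a `p`-th power form». [cite: Matsumura1987, §27 (higher derivations)]
[cite: VillamayorU2008ReesDiff, §4.1 and Remark 4.3] -/
theorem forall_hsComponent_mem_sq_iff_dvd (p : ℕ) [CharP (ResidueField O) p] (hT0 : ∀ b, constantCoeff (T b) = b)
    {u : σ → O} (hu : Ideal.span (Set.range u) = maximalIdeal O)
    (hlin : ∀ i j, hsComponent T (single j 1) (u i) - (if i = j then 1 else 0) ∈ maximalIdeal O)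
    {N : ℕ} {h : O} (hh : h ∈ maximalIdeal O ^ (N + 1)) :
    (∀ β : σ →₀ ℕ, degree β ≤ N → hsComponent T β h ∈ maximalIdeal O ^ 2) ↔
      ∀ γ : σ →₀ ℕ, degree γ = N + 1 → hsComponent T γ h ∉ maximalIdeal O → ∀ l, p ∣ γ l := by
  rw [forall_hsComponent_mem_sq_iff T hT0 hu hlin hh]
  refine forall_congr' fun γ => forall_congr' fun hγ => ?_
  constructor
  · intro H hnot l
    rcases (Ideal.IsMaximal.isPrime' (maximalIdeal O)).mem_or_mem (H l) with h1 | h1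
    · exact (natCast_mem_maximalIdeal_iff p _).mp h1
    · exact absurd h1 hnot
  · intro H l
    by_cases hmem : hsComponent T γ h ∈ maximalIdeal O
    · exact Ideal.mul_mem_left _ _ hmem
    · exact Ideal.mul_mem_right _ _ ((natCast_mem_maximalIdeal_iff p _).mpr (H hmem l))

/-- **An element of order exactly `N + 1` with `p ∤ N + 1` has a Hasse–Schmidt component of order `N` with `𝔪`-adic order EXACTLY
`1`** (`p` the residue characteristic, prime or `0`): some monomial of the initial form has an exponent prime to `p`, so not all
components of order `≤ N` lie in `𝔪²`; those of order `< N` do, and all of order `≤ N` lie in `𝔪`. This REFINES the unit form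
`exists_hsComponent_isUnit_of_mem_of_not_mem` (order `N + 1` reaches a unit) in the TAME case. [cite: Matsumura1987, §27 (higher derivations)]
[cite: VillamayorU2008ReesDiff, §4.1 and Remark 4.3] -/
theorem exists_hsComponent_adicOrder_eq_one (p : ℕ) [CharP (ResidueField O) p] (hT0 : ∀ b, constantCoeff (T b) = b)
    {u : σ → O} (hu : Ideal.span (Set.range u) = maximalIdeal O)
    (hlin : ∀ i j, hsComponent T (single j 1) (u i) - (if i = j then 1 else 0) ∈ maximalIdeal O)
    {N : ℕ} {h : O} (h1 : h ∈ maximalIdeal O ^ (N + 1)) (h2 : h ∉ maximalIdeal O ^ (N + 2)) (hp : ¬ p ∣ N + 1) :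
    ∃ β : σ →₀ ℕ, degree β = N ∧ adicOrder (hsComponent T β h) = 1 := by
  obtain ⟨γ, hγ, hunit⟩ := exists_hsComponent_isUnit_of_mem_of_not_mem T hT0 hu hlin h1 h2
  obtain ⟨l, hl⟩ := exists_not_dvd_apply (p := p) (β := γ) (hγ ▸ hp)
  have hγunit : hsComponent T γ h ∉ maximalIdeal O := fun hmem => (mem_maximalIdeal _).mp hmem hunit
  have hnot : ¬ ∀ β : σ →₀ ℕ, degree β ≤ N → hsComponent T β h ∈ maximalIdeal O ^ 2 := fun H =>
    hl ((forall_hsComponent_mem_sq_iff_dvd T p hT0 hu hlin h1).mp H γ hγ hγunit l)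
  simp only [not_forall] at hnot
  obtain ⟨β, hβ, hβsq⟩ := hnot
  refine ⟨β, ?_, ?_⟩
  · by_contra hne
    apply hβsq
    have := hsComponent_mem_pow T hT0 (maximalIdeal O) (N + 1) β h1
    exact Ideal.pow_le_pow_right (by omega) this
  · rw [adicOrder_eq_one_iff]
    exact ⟨hsComponent_mem_maximalIdeal_of_mem_pow T hT0 h1 hβ, hβsq⟩

/-- **The WILD alternative**: if `h` has order exactly `N + 1` and ALL its Hasse–Schmidt components of order `≤ N` lie in `𝔪²`, then
`p ∣ N + 1` (`p` the residue characteristic). [cite: Matsumura1987, §27 (higher derivations)] [cite: VillamayorU2008ReesDiff, §4.1 and Remark 4.3] -/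
theorem dvd_of_forall_hsComponent_mem_sq (p : ℕ) [CharP (ResidueField O) p] (hT0 : ∀ b, constantCoeff (T b) = b)
    {u : σ → O} (hu : Ideal.span (Set.range u) = maximalIdeal O)
    (hlin : ∀ i j, hsComponent T (single j 1) (u i) - (if i = j then 1 else 0) ∈ maximalIdeal O)
    {N : ℕ} {h : O} (h1 : h ∈ maximalIdeal O ^ (N + 1)) (h2 : h ∉ maximalIdeal O ^ (N + 2))
    (H : ∀ β : σ →₀ ℕ, degree β ≤ N → hsComponent T β h ∈ maximalIdeal O ^ 2) : p ∣ N + 1 := by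
  by_contra hp
  obtain ⟨β, hβ, hord⟩ := exists_hsComponent_adicOrder_eq_one T p hT0 hu hlin h1 h2 hp
  exact ((adicOrder_eq_one_iff _).mp hord).2 (H β hβ.le)

end Criterion

end Literature.AlgebraicGeometry.Resolution

end
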